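import Summits.BirchSwinnertonDyer.BirchSwinnertonDyer.Theorems.SchneiderFreeAdditiveX3PoitouTateShaZModMuHolds
import Literature.NumberTheory.GaloisCohomology.ShaOneMuPrime
import Literature.NumberTheory.GaloisCohomology.ShaOneMuTwoPow
import Literature.NumberTheory.GaloisRepresentations.ProjectiveLiftingOfPoitouTate
import HarnessLib

/-!
# Consequences of `poitouTate_sha_zmod_mu_holds`: `Ш²(K, ℤ/pⁿ) = 0`, Tate's theorem `H²(Γ_K, ℚ/ℤ) = 0` (odd part for every
# number field; all of it for `K ∋ √-1`), and the Patrikis lifting facts modulo `(H_2)` on the Grunwald–Wang locus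

Cell `bsd-schneider-ideate`, seat `bsd-schneider-door-c4` (prover, generation 20); sibling of
`SchneiderFreeAdditiveX3PoitouTateShaZModMuHolds.lean` (the named fact `poitouTate_sha_zmod_mu K` for every number field).
PARTITION / bears_on: as there (CONTROL corner of board row B6 ∩ X3 ∩ sst-twist, r = 1; K1-door items 18969 → 19295, 19538).

The tree's theorems below carried `Literature.NumberTheory.GaloisCohomology.poitouTate_sha_zmod_mu K` as their ONLY named
input; fed with `poitouTate_sha_zmod_mu_holds K` they become unconditional:
* `shaTwo_trivial_zmod_primePow_eq_bot_of_odd` — `Ш²(K, ℤ/pⁿ) = 0` for every number field `K` and odd `p`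
  (`ShaOneMuPrime.shaTwo_zmod_primePow_eq_bot_of_odd`, Harari Cor. 18.12 + Thm. 18.9);
  `…_of_isPrimitiveRoot` (`K ⊇ μ_{pⁿ}`, any `p`); `shaTwo_trivial_zmod_twoPow_eq_bot_of_isPrimitiveRoot_four` (`K ∋ √-1`,
  `ShaOneMuTwoPow`);
* **Tate's theorem** (Serre, Durham 1977, §6.1 Thm. 4; Harari Thm. 18.15 / Cor. 18.17) in the tree's cochain form:
  `tate_twoCocycle_addCircle_prime_split_of_odd` — `H²(Γ_K, ℚ_p/ℤ_p) = 0` for EVERY number field and every odd `p`;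
  `tate_twoCocycle_addCircle_prime_split_of_isPrimitiveRoot_four` — `(H_p)(Γ_K)` for every `p` when `√-1 ∈ K`;
  `tate_twoCocycle_addCircle_split_of_isPrimitiveRoot_four` — `H²(Γ_K, ℚ/ℤ) = 0` for every number field `K ∋ √-1`
  (`ProjectiveLiftingOfPoitouTate.twoCocycle_addCircle_*_of_poitouTate_*`);
* `Patrikis2019_exists_lift_projective_of_H2_two`, `Patrikis2019_exists_spinLift_of_H2_two` — the named facts
  `Patrikis2019_exists_lift_projective` / `Patrikis2019_exists_spinLift` (Patrikis 2019 §2.1 Prop. 1.0.18 and Remark) from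
  `(H_2)(Γ_K)` for the number fields `K ∌ √-1` ALONE (the Grunwald–Wang locus; Harari Rem. 18.11).

HONEST FRAMING.  By-name discharges only (theorems; no definition, no named fact, no `sorry`).  NOT a case of BSD; closes no
route item («closes rung: none»).  The `2`-primary part of Tate's theorem for number fields WITHOUT `√-1` is NOT proved here:
it is exactly the hypothesis `h2` of the last two theorems.

## References
* D. Harari, *Galois Cohomology and Class Field Theory* (2020), Thm. 18.9, Rem. 18.11, Cor. 18.12, Thm. 18.15, Cor. 18.17. [Harari2020]
* J.-P. Serre, *Modular forms of weight one and Galois representations* (Durham 1977), §6.1 Thm. 4, §6.5. [SerreDurham1977]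
* S. Patrikis, *Variations on a theorem of Tate*, Mem. AMS 258 (2019), §2.1. [Patrikis2019]
-/

noncomputable section

-- `Summit.<P>.<Sub>` repeats `BirchSwinnertonDyer` by the tree's layout convention (D-0017)
set_option linter.dupNamespace false

namespace Summit.BirchSwinnertonDyer.BirchSwinnertonDyer.Theorems.SchneiderFreeAdditiveX3.PoitouTateReduction

open Literature.NumberTheory.GaloisRepresentations Literature.NumberTheory.GaloisCohomology
open Literature.NumberTheory.GaloisRepresentations.DiscreteGaloisModule
open Field Function NumberField

/-! ## Consequences: the tree's theorems that took `poitouTate_sha_zmod_mu K` as a hypothesis, now unconditional -/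

section Consequences

variable (K : Type) [Field K] [NumberField K]

/-- **`Ш²(K, ℤ/pⁿ) = 0` for EVERY number field `K` and every ODD prime `p`** (Harari Cor. 18.12 with Thm. 18.9: duality
with `Ш¹(K, μ_{pⁿ}) = 0`, no Grunwald–Wang exceptional case for odd `p`) — the tree's
`shaTwo_zmod_primePow_eq_bot_of_odd` with its Poitou–Tate hypothesis discharged. [cite: Harari2020, Cor. 18.12 and Thm. 18.9] -/
theorem shaTwo_trivial_zmod_primePow_eq_bot_of_odd {p : ℕ} (hp : p.Prime) (hp2 : p ≠ 2) (n : ℕ) :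
    haveI : NeZero (p ^ n) := ⟨pow_ne_zero n hp.ne_zero⟩
    shaTwo (ContinuousRep.trivial (absoluteGaloisGroup K) ℤ (ZMod (p ^ n))) = ⊥ :=
  Literature.NumberTheory.GaloisCohomology.shaTwo_zmod_primePow_eq_bot_of_odd
    (poitouTate_sha_zmod_mu_holds K) hp hp2 n

/-- **`Ш²(K, ℤ/pⁿ) = 0` for a number field `K ⊇ μ_{pⁿ}`** (any prime `p`; Harari Cor. 18.12 with Thm. 18.9) — the tree's
`shaTwo_zmod_primePow_eq_bot_of_isPrimitiveRoot`, Poitou–Tate hypothesis discharged. [cite: Harari2020, Cor. 18.12 and Thm. 18.9] -/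
theorem shaTwo_trivial_zmod_primePow_eq_bot_of_isPrimitiveRoot {p : ℕ} (hp : p.Prime) (n : ℕ) {ζ : K}
    (hζ : IsPrimitiveRoot ζ (p ^ n)) :
    haveI : NeZero (p ^ n) := ⟨pow_ne_zero n hp.ne_zero⟩
    shaTwo (ContinuousRep.trivial (absoluteGaloisGroup K) ℤ (ZMod (p ^ n))) = ⊥ :=
  Literature.NumberTheory.GaloisCohomology.shaTwo_zmod_primePow_eq_bot_of_isPrimitiveRoot
    (poitouTate_sha_zmod_mu_holds K) hp n hζ

/-- **`Ш²(K, ℤ/2ⁿ) = 0` for a number field `K ∋ √-1`** (Harari Cor. 18.12 with Thm. 18.9 and Rem. 18.11: no exceptional case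
when `√-1 ∈ K`) — the tree's `shaTwo_zmod_twoPow_eq_bot_of_isPrimitiveRoot_four`, Poitou–Tate hypothesis discharged.
[cite: Harari2020, Cor. 18.12, Thm. 18.9 and Rem. 18.11] -/
theorem shaTwo_trivial_zmod_twoPow_eq_bot_of_isPrimitiveRoot_four {i : K} (hi : IsPrimitiveRoot i 4) (n : ℕ) :
    haveI : NeZero (2 ^ n) := ⟨pow_ne_zero n two_ne_zero⟩
    shaTwo (ContinuousRep.trivial (absoluteGaloisGroup K) ℤ (ZMod (2 ^ n))) = ⊥ :=
  Literature.NumberTheory.GaloisCohomology.shaTwo_zmod_twoPow_eq_bot_of_isPrimitiveRoot_four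
    (poitouTate_sha_zmod_mu_holds K) hi n

/-- **Tate's theorem, odd part, for EVERY number field: `H²(Γ_K, ℚ_p/ℤ_p) = 0` (`p` odd), cochain form** — every locally
constant `p`-torsion `2`-cocycle `Γ_K × Γ_K → ℚ/ℤ` is the coboundary of a locally constant cochain (Serre, Durham §6.1 Thm. 4
and §6.5; Harari Thm. 18.15).  The tree's `twoCocycle_addCircle_prime_split_of_poitouTate_of_odd` with its only named input,
`poitouTate_sha_zmod_mu K`, discharged. [cite: SerreDurham1977, §6.1 Thm. 4 and §6.5] [cite: Harari2020, Thm. 18.15, Cor. 18.12] -/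
theorem tate_twoCocycle_addCircle_prime_split_of_odd {p : ℕ} (hp : p.Prime) (hp2 : p ≠ 2)
    (g : absoluteGaloisGroup K → absoluteGaloisGroup K → AddCircle (1 : ℚ))
    (hg : IsLocallyConstant (Function.uncurry g))
    (hcoc : ∀ σ τ υ, g σ τ + g (σ * τ) υ = g τ υ + g σ (τ * υ)) (hpg : ∀ σ τ, p • g σ τ = 0) :
    ∃ b : absoluteGaloisGroup K → AddCircle (1 : ℚ), IsLocallyConstant b ∧
      ∀ σ τ, g σ τ + b (σ * τ) = b σ + b τ :=
  twoCocycle_addCircle_prime_split_of_poitouTate_of_odd K (poitouTate_sha_zmod_mu_holds K) hp hp2 g hg hcoc hpg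

/-- **`(H_p)(Γ_K)` for EVERY prime `p` when `√-1 ∈ K`** — every locally constant `p`-torsion `2`-cocycle splits (Serre §6.5;
Harari Thm. 18.15 with Rem. 18.11); the tree's `twoCocycle_addCircle_prime_split_of_poitouTate_of_isPrimitiveRoot_four`,
Poitou–Tate hypothesis discharged. [cite: SerreDurham1977, §6.1 Thm. 4 and §6.5] [cite: Harari2020, Thm. 18.15 and Rem. 18.11] -/
theorem tate_twoCocycle_addCircle_prime_split_of_isPrimitiveRoot_four {i : K} (hi : IsPrimitiveRoot i 4) {p : ℕ}
    (hp : p.Prime) (g : absoluteGaloisGroup K → absoluteGaloisGroup K → AddCircle (1 : ℚ))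
    (hg : IsLocallyConstant (Function.uncurry g))
    (hcoc : ∀ σ τ υ, g σ τ + g (σ * τ) υ = g τ υ + g σ (τ * υ)) (hpg : ∀ σ τ, p • g σ τ = 0) :
    ∃ b : absoluteGaloisGroup K → AddCircle (1 : ℚ), IsLocallyConstant b ∧
      ∀ σ τ, g σ τ + b (σ * τ) = b σ + b τ :=
  twoCocycle_addCircle_prime_split_of_poitouTate_of_isPrimitiveRoot_four K (poitouTate_sha_zmod_mu_holds K) hi hp g hg
    hcoc hpg

/-- **Tate's theorem `H²(Γ_K, ℚ/ℤ) = 0` for EVERY number field `K ∋ √-1`, cochain form, UNCONDITIONAL** (Serre, Durham §6.1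
Thm. 4 (Tate); Harari Thm. 18.15 / Cor. 18.17): every locally constant `2`-cocycle `Γ_K × Γ_K → ℚ/ℤ` is the coboundary of
a locally constant cochain.  The tree's `twoCocycle_addCircle_split_of_poitouTate_of_isPrimitiveRoot_four` with its only named
input discharged.  (For `K ∌ √-1` the `2`-part on the Grunwald–Wang locus is not covered here — see
`Patrikis2019_exists_lift_projective_of_H2_two`.) [cite: SerreDurham1977, §6.1 Thm. 4 (Tate)] [cite: Harari2020, Thm. 18.15 and Cor. 18.17] -/
theorem tate_twoCocycle_addCircle_split_of_isPrimitiveRoot_four {i : K} (hi : IsPrimitiveRoot i 4)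
    (f : absoluteGaloisGroup K → absoluteGaloisGroup K → AddCircle (1 : ℚ))
    (hf : IsLocallyConstant (Function.uncurry f))
    (hcoc : ∀ σ τ υ, f σ τ + f (σ * τ) υ = f τ υ + f σ (τ * υ)) :
    ∃ b : absoluteGaloisGroup K → AddCircle (1 : ℚ), IsLocallyConstant b ∧
      ∀ σ τ, f σ τ + b (σ * τ) = b σ + b τ :=
  twoCocycle_addCircle_split_of_poitouTate_of_isPrimitiveRoot_four K (poitouTate_sha_zmod_mu_holds K) hi f hf hcoc

/-- **Patrikis' lifting theorem with control of ramification (the named fact `Patrikis2019_exists_lift_projective`) from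
Tate's theorem at `p = 2` on the Grunwald–Wang locus ALONE**: the Poitou–Tate input of the tree's
`Patrikis2019_exists_lift_projective_of_poitouTate_of_two_without_sqrt_neg_one` is discharged for every number field; what
remains is `(H_2)(Γ_K)` — every locally constant `2`-torsion `2`-cocycle splits — for the number fields `K ∌ √-1`.
[cite: Patrikis2019, §2.1 Theorem (Tate) = arXiv Thm. 1.0.16, Prop. 1.0.18 and Remark] [cite: Harari2020, Cor. 18.17 and Rem. 18.11] -/
theorem Patrikis2019_exists_lift_projective_of_H2_two
    (h2 : ∀ (K : Type) [Field K] [NumberField K], (¬ ∃ i : K, IsPrimitiveRoot i 4) →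
      ∀ g : absoluteGaloisGroup K → absoluteGaloisGroup K → AddCircle (1 : ℚ),
        IsLocallyConstant (Function.uncurry g) →
        (∀ σ τ υ, g σ τ + g (σ * τ) υ = g τ υ + g σ (τ * υ)) → (∀ σ τ, 2 • g σ τ = 0) →
        ∃ c : absoluteGaloisGroup K → AddCircle (1 : ℚ), IsLocallyConstant c ∧
          ∀ σ τ, g σ τ + c (σ * τ) = c σ + c τ) :
    Patrikis2019_exists_lift_projective :=
  Patrikis2019_exists_lift_projective_of_poitouTate_of_two_without_sqrt_neg_one
    (fun K _ _ => poitouTate_sha_zmod_mu_holds K) h2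

/-- **The spin-lift fact `Patrikis2019_exists_spinLift` from `(H_2)(Γ_K)` on the Grunwald–Wang locus alone** (Patrikis §2.1
Proposition and Remark for `GSpin₆ ↠ SO₆`), Poitou–Tate input discharged.
[cite: Patrikis2019, §2.1 Proposition and Remark (= arXiv Prop. 1.0.18, Rem. 1.0.19)] -/
theorem Patrikis2019_exists_spinLift_of_H2_two
    (h2 : ∀ (K : Type) [Field K] [NumberField K], (¬ ∃ i : K, IsPrimitiveRoot i 4) →
      ∀ g : absoluteGaloisGroup K → absoluteGaloisGroup K → AddCircle (1 : ℚ),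
        IsLocallyConstant (Function.uncurry g) →
        (∀ σ τ υ, g σ τ + g (σ * τ) υ = g τ υ + g σ (τ * υ)) → (∀ σ τ, 2 • g σ τ = 0) →
        ∃ c : absoluteGaloisGroup K → AddCircle (1 : ℚ), IsLocallyConstant c ∧
          ∀ σ τ, g σ τ + c (σ * τ) = c σ + c τ) :
    Patrikis2019_exists_spinLift :=
  Patrikis2019_exists_spinLift_of_poitouTate_of_two_without_sqrt_neg_one
    (fun K _ _ => poitouTate_sha_zmod_mu_holds K) h2

end Consequences

end Summit.BirchSwinnertonDyer.BirchSwinnertonDyer.Theorems.SchneiderFreeAdditiveX3.PoitouTateReduction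

end
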